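import Mathlib
import Literature.MathematicalPhysics.QuantumFieldTheory.UniformTorusClusteringProofs

/-!
# LatticeQCDFlow / Scaling — a volume-uniform FLOOR on truncated correlations at strong coupling
# from the leading Taylor coefficient (item 120; hypothesis (U)/(U′) of the volume law)

HONEST FRAMING: exact (Metropolis-corrected) sampling algorithms for lattice gauge theory;
figures of merit are autocorrelation/cost numbers at stated couplings and volumes; no
continuum-physics claim.

Venture `LatticeQCDFlow` (cell pub-lqcd), topic `Scaling`, item 120 of HOME/THEORY-2.md §3.1 (hw) /
§4 row T2-AK (v4.7).  The volume / receptive-field law of an exact local flow sampler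
(`Barriers.VolumeScalingOfTraining`, `Theory2.BlockDefectVolumeLaw`, `Barriers.ReceptiveFieldLaw`)
has ONE non-theorem input, the uniform clustering FLOOR (U): a connected correlation of two bounded
local observables at fixed separation is bounded BELOW by some `δ > 0` UNIFORMLY IN THE VOLUME.
The UPPER bound (exponential clustering, uniformly in the volume) is a theorem of the tree at strong
coupling (`osterwalder_seiler_torusClustering_uniform_holds` [cite: OsterwalderSeilerAnnPhys1978,
Thm. 3.5 with Remark (3.9)]).  This file proves the ANALYTIC half of the lower bound and isolates
the combinatorial half (LC):
* `norm_sub_leading_le`, `leading_floor` — the kernel: `T` holomorphic on `‖z‖ < R`, bounded by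
  `K`, `T(z) − b zⁿ = O(z^{n+1})` at `0` ⇒ `‖T(z) − b zⁿ‖ ≤ (K + ‖b‖Rⁿ)(‖z‖/r)^{n+1}` on
  `‖z‖ ≤ r < R` (the tree's Schwarz lemma with multiplicity `norm_le_of_isBigO_pow`), hence
  `‖T(z)‖ ≥ ‖b‖‖z‖ⁿ/2` for `‖z‖ ≤ β⋆ := ‖b‖ r^{n+1} / (2 (K + ‖b‖ Rⁿ))` — a threshold depending
  on `(b, n, K, r, R)` ONLY: uniform over every family of functions sharing these data.
* `PlaqSystem.truncated_floor_of_leading` — for an abstract plaquette system at strong coupling the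
  truncated expectation of two bounded local observables is holomorphic and bounded on the disc
  uniformly in the finite label set `V` (tree: `differentiableOn_expect`,
  `norm_truncatedExpect_le_const`); so IF its jet at `0` starts with `b βⁿ`, `b ≠ 0` (LC), THEN
  `‖⟨F₁;F₂⟩_V(β)‖ ≥ ‖b‖‖β‖ⁿ/2` for `‖β‖ ≤ β⋆`, `β⋆` independent of `V`.
* `torus_truncated_floor_of_leadingCoeff` / `torus_clusteringFloor_of_leadingCoeff` — the torus
  Wilson states of side `L+1` (`wilsonExpectation`, periodised observables `toTorusObservable`):
  if for every `L ∈ good` the complex truncated expectation `torusTruncC` of `F₁`, `F₂ ∘ θ_x` has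
  leading term `b βⁿ` with ONE `b ≠ 0` and ONE `n` (the `O`-constants may depend on `L`), then ONE
  `β₀ > 0` gives `|⟨F₁ (F₂∘θ_x)⟩ − ⟨F₁⟩⟨F₂∘θ_x⟩| ≥ |b| |β|ⁿ / 2` for all real `|β| ≤ β₀` and ALL
  `L ∈ good`: hypothesis (U′) at strong coupling with the explicit floor `δ(β) = |b| βⁿ / 2`.

What is NOT proved here (hypothesis (LC), the successor's target, β-free and volume-combinatorial):
for two parallel plaquettes stacked at separation `t` along a third axis (`d ≥ 3`) and the Wilson
action, `n = 4t` and `b = 2^{-(4t+1)} N^{-4t}` for `G = U(1)` (`N = 1`) and `G = SU(N)`, `N ≥ 3`,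
fundamental `Re tr` (cumulant expansion at `β = 0`: a joint cumulant of plaquette variables under
product Haar measure vanishes as soon as one bond is covered by one plaquette only; the minimal
closed connected completion of the two plaquettes is the tube of `4t` plaquettes, unique at that
size; the Haar integral of the closed surface of `4t+2` fundamental characters is
`2 · (2N)^{-(4t+2)} · N² = 2^{-(4t+1)} N^{-4t}`), for all `L' ≥ L₀(t)`, `L₀(t) = 2t + 1`.  This is
the printed leading term of the strong-coupling series of the plaquette–plaquette correlation
("a long tube connecting p₁ and p₂, containing 4t+2 plaquettes … contribution A u^{4t}",
[cite: MontvayMunster1994, §3.6.2 eq. (3.437)]) and, rigorously for boxes `Λ ⊂ ℤ^d` with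
`Λ`-independent constants, Schor's hyperplane-decoupling computation (derivatives in the couplings
of one time slab vanish to order three; the fourth is `c₄ > 0` times the product of the two cap
characters, `∫ ∏_{i=1}^{4} χ(g_{P_i}) = χ(g_{P₅}) χ(g_{P₆}) / d⁴`) [cite: Schor1984, Thm 3.1,
Thm 3.2, eq. (3.13)].  LITERATURE GRADE (honest): known mechanism (Osterwalder–Seiler analyticity
+ the leading tube); new here = kernel-checked, on the periodic torus in every `d`, with the
explicit volume-uniform threshold `β⋆`, typed against the venture's (U′)
`Conjectures.CrossCutCorrelatorFloor`.  See THEORY-2.md §3.1 (hw) / §5.28 for the proof sketch of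
(LC) and the Lean plan over `PlaqSystemReplicaFormula` (the tree's doubled-measure formula is
Schor's `(φ̄ − φ̄')(ψ − ψ')` device).

References: K. Osterwalder, E. Seiler, Ann. Phys. 110 (1978) 440, §3 [OsterwalderSeilerAnnPhys1978];
E. Seiler, LNP 159 (1982) Ch. 2–3 [SeilerLNP1982]; R. Schor, Commun. Math. Phys. 92 (1984) 369–395
[Schor1984]; I. Montvay, G. Münster, *Quantum Fields on a Lattice* (1994) §3.4.4, §3.6.2
[MontvayMunster1994].  Elementary given the tree; farm `lean check` rc 0, no `sorry`.
-/

noncomputable section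

open MeasureTheory Filter Asymptotics Finset
open scoped Topology
open Literature.MathematicalPhysics.QuantumFieldTheory
open Literature.MathematicalPhysics.QuantumLattice (configShift toTorusObservable IsCylinder)

namespace Summit.Ventures.LatticeQCDFlow.Theory2

/-! ## 1. The analytic kernel: a floor from the leading Taylor coefficient -/

section Kernel

/-- **Remainder after the leading term (Schwarz lemma with multiplicity).**  If `T` is holomorphic
on the disc `‖z‖ < R`, bounded there by `K`, and `T(z) − b zⁿ = O(z^{n+1})` at `0`, then
`‖T(z) − b zⁿ‖ ≤ (K + ‖b‖ Rⁿ) (‖z‖/r)^{n+1}` for `‖z‖ ≤ r < R`. [folklore] -/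
theorem norm_sub_leading_le {T : ℂ → ℂ} {R K : ℝ} (hd : DifferentiableOn ℂ T (Metric.ball 0 R))
    (hK : ∀ z ∈ Metric.ball (0 : ℂ) R, ‖T z‖ ≤ K) {n : ℕ} {b : ℂ}
    (hO : (fun z => T z - b * z ^ n) =O[𝓝 (0 : ℂ)] fun z => z ^ (n + 1))
    {r : ℝ} (hr : 0 < r) (hrR : r < R) {z : ℂ} (hz : ‖z‖ ≤ r) :
    ‖T z - b * z ^ n‖ ≤ (K + ‖b‖ * R ^ n) * (‖z‖ / r) ^ (n + 1) := by
  refine norm_le_of_isBigO_pow (h := fun z => T z - b * z ^ n) ?_ ?_ hO hr hrR hz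
  · exact hd.sub ((differentiableOn_const b).mul (differentiableOn_id.pow n))
  · intro w hw
    have hw' : ‖w‖ < R := by rwa [Metric.mem_ball, dist_zero_right] at hw
    calc ‖T w - b * w ^ n‖ ≤ ‖T w‖ + ‖b * w ^ n‖ := norm_sub_le _ _
      _ ≤ K + ‖b‖ * R ^ n := by
        refine add_le_add (hK w hw) ?_
        rw [norm_mul, norm_pow]
        exact mul_le_mul_of_nonneg_left (pow_le_pow_left₀ (norm_nonneg _) hw'.le n)
          (norm_nonneg _)

/-- **The floor from the leading coefficient.**  Under the hypotheses of `norm_sub_leading_le` with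
`b ≠ 0`: `‖T(z)‖ ≥ ‖b‖ ‖z‖ⁿ / 2` whenever `‖z‖ ≤ β⋆ := ‖b‖ r^{n+1} / (2 (K + ‖b‖ Rⁿ))`.  The
threshold `β⋆` depends on `(b, n, K, r, R)` only — uniform over every family of functions sharing
these data. [folklore] -/
theorem leading_floor {T : ℂ → ℂ} {R K : ℝ} (hd : DifferentiableOn ℂ T (Metric.ball 0 R))
    (hK : ∀ z ∈ Metric.ball (0 : ℂ) R, ‖T z‖ ≤ K) {n : ℕ} {b : ℂ} (hb : b ≠ 0)
    (hO : (fun z => T z - b * z ^ n) =O[𝓝 (0 : ℂ)] fun z => z ^ (n + 1))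
    {r : ℝ} (hr : 0 < r) (hrR : r < R) {z : ℂ}
    (hz : ‖z‖ ≤ ‖b‖ * r ^ (n + 1) / (2 * (K + ‖b‖ * R ^ n))) :
    ‖b‖ * ‖z‖ ^ n / 2 ≤ ‖T z‖ := by
  have hR : 0 < R := hr.trans hrR
  have hb' : 0 < ‖b‖ := norm_pos_iff.2 hb
  have hK0 : 0 ≤ K := (norm_nonneg _).trans (hK 0 (Metric.mem_ball_self hR))
  set K' : ℝ := K + ‖b‖ * R ^ n with hK'
  have hK'pos : 0 < K' := by positivity
  have hbrn : ‖b‖ * r ^ n ≤ K' := by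
    have h1 : r ^ n ≤ R ^ n := pow_le_pow_left₀ hr.le hrR.le n
    have h2 : ‖b‖ * r ^ n ≤ ‖b‖ * R ^ n := mul_le_mul_of_nonneg_left h1 hb'.le
    linarith
  -- the threshold lies inside the disc of radius `r`
  have hzr : ‖z‖ ≤ r := by
    refine hz.trans ?_
    rw [div_le_iff₀ (by positivity)]
    calc ‖b‖ * r ^ (n + 1) = r * (‖b‖ * r ^ n) := by ring
      _ ≤ r * (2 * K') := by
          refine mul_le_mul_of_nonneg_left ?_ hr.le
          linarith
  have hE := norm_sub_leading_le hd hK hO hr hrR hzr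
  -- `K' (‖z‖/r)^{n+1} ≤ ‖b‖ ‖z‖ⁿ / 2` by the choice of the threshold
  have hz2 : ‖z‖ * (2 * K') ≤ ‖b‖ * r ^ (n + 1) := (le_div_iff₀ (by positivity)).1 hz
  have hq : K' * ‖z‖ / r ^ (n + 1) ≤ ‖b‖ / 2 := by
    rw [div_le_div_iff₀ (pow_pos hr _) two_pos]
    linarith
  have hkey : K' * (‖z‖ / r) ^ (n + 1) ≤ ‖b‖ * ‖z‖ ^ n / 2 := by
    have heq : K' * (‖z‖ / r) ^ (n + 1) = K' * ‖z‖ / r ^ (n + 1) * ‖z‖ ^ n := by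
      rw [div_pow]; ring
    rw [heq]
    calc K' * ‖z‖ / r ^ (n + 1) * ‖z‖ ^ n ≤ ‖b‖ / 2 * ‖z‖ ^ n :=
          mul_le_mul_of_nonneg_right hq (by positivity)
      _ = ‖b‖ * ‖z‖ ^ n / 2 := by ring
  have h1 : ‖b * z ^ n‖ = ‖b‖ * ‖z‖ ^ n := by rw [norm_mul, norm_pow]
  have h2 : ‖b * z ^ n‖ - ‖T z - b * z ^ n‖ ≤ ‖T z‖ := by
    have := norm_sub_norm_le (b * z ^ n) (b * z ^ n - T z)
    rw [sub_sub_cancel, norm_sub_rev (b * z ^ n) (T z)] at this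
    exact this
  calc ‖b‖ * ‖z‖ ^ n / 2 = ‖b‖ * ‖z‖ ^ n - ‖b‖ * ‖z‖ ^ n / 2 := by ring
    _ ≤ ‖b * z ^ n‖ - ‖T z - b * z ^ n‖ := by rw [h1]; linarith [hE.trans hkey]
    _ ≤ ‖T z‖ := h2

/-- The threshold of `leading_floor` is positive. [folklore] -/
theorem leading_threshold_pos {R K r : ℝ} (hK : 0 ≤ K) (hR : 0 < R) (hr : 0 < r) {n : ℕ} {b : ℂ}
    (hb : b ≠ 0) : 0 < ‖b‖ * r ^ (n + 1) / (2 * (K + ‖b‖ * R ^ n)) := by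
  have hb' : 0 < ‖b‖ := norm_pos_iff.2 hb
  positivity

end Kernel

/-! ## 2. Abstract plaquette systems at strong coupling -/

section System
open PlaqSystem
variable {d : ℕ} {G : Type*} {ι : Type*} {S : PlaqSystem d G ι} [DecidableEq ι]
  [Group G] [TopologicalSpace G] [IsTopologicalGroup G] [CompactSpace G]
  [MeasurableSpace G] [BorelSpace G] {M : ℝ} {D : ℕ}

/-- **Volume-uniform floor on a truncated expectation from its leading coefficient** (abstract
plaquette system, `StrongCouplingPolymerSystem`).  `F₁, F₂` bounded measurable, supported on bond
sets `B₁, B₂`; `K` any bound for the uniform constant of `norm_truncatedExpect_le_const`;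
`0 < r < R ≤ β_R`.  IF the truncated expectation `τ_V(β) = ⟨F₁F₂⟩_V − ⟨F₁⟩_V⟨F₂⟩_V` satisfies
`τ_V(β) − b βⁿ = O(β^{n+1})` at `β = 0` with `b ≠ 0` (hypothesis (LC)), THEN
`‖τ_V(β)‖ ≥ ‖b‖‖β‖ⁿ/2` for `‖β‖ ≤ ‖b‖ r^{n+1} / (2 (K + ‖b‖ Rⁿ))` — a threshold independent of
the label set `V` (the volume). [folklore] -/
theorem PlaqSystem.truncated_floor_of_leading (hR : S.Regular M D) {B₁ B₂ : Finset (ZdEdge d)}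
    {F₁ F₂ : ZdGaugeConfig d G → ℂ} (h₁m : Measurable F₁) (h₂m : Measurable F₂) {C₁ C₂ : ℝ}
    (h₁b : ∀ U, ‖F₁ U‖ ≤ C₁) (h₂b : ∀ U, ‖F₂ U‖ ≤ C₂)
    (hF₁ : DependsOn F₁ (B₁ : Set (ZdEdge d))) (hF₂ : DependsOn F₂ (B₂ : Set (ZdEdge d)))
    (V : Finset ι) {K : ℝ}
    (hK : C₁ * C₂ * (2 * Real.exp (1 / 2)) ^ (S.seedsOf (B₁ ∪ B₂)).card +
        C₁ * (2 * Real.exp (1 / 2)) ^ (S.seedsOf B₁).card *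
          (C₂ * (2 * Real.exp (1 / 2)) ^ (S.seedsOf B₂).card) ≤ K)
    {r R : ℝ} (hr : 0 < r) (hrR : r < R) (hRβ : R ≤ betaR M D)
    {n : ℕ} {b : ℂ} (hb : b ≠ 0)
    (hLC : (fun β => (S.expect (fun U => F₁ U * F₂ U) V β - S.expect F₁ V β * S.expect F₂ V β) -
        b * β ^ n) =O[𝓝 (0 : ℂ)] fun β => β ^ (n + 1))
    {β : ℂ} (hβ : ‖β‖ ≤ ‖b‖ * r ^ (n + 1) / (2 * (K + ‖b‖ * R ^ n))) :
    ‖b‖ * ‖β‖ ^ n / 2 ≤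
      ‖S.expect (fun U => F₁ U * F₂ U) V β - S.expect F₁ V β * S.expect F₂ V β‖ := by
  have hC₁ : 0 ≤ C₁ := (norm_nonneg _).trans (h₁b fun _ => 1)
  have h12 : ∀ U, ‖F₁ U * F₂ U‖ ≤ C₁ * C₂ := fun U => by
    rw [norm_mul]; exact mul_le_mul (h₁b U) (h₂b U) (norm_nonneg _) hC₁
  have hdiff : DifferentiableOn ℂ
      (fun β => S.expect (fun U => F₁ U * F₂ U) V β - S.expect F₁ V β * S.expect F₂ V β)
      (Metric.ball 0 R) :=
    ((differentiableOn_expect hR (h₁m.mul h₂m) h12 V).sub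
      ((differentiableOn_expect hR h₁m h₁b V).mul (differentiableOn_expect hR h₂m h₂b V))).mono
      (Metric.ball_subset_ball hRβ)
  have hKball : ∀ z ∈ Metric.ball (0 : ℂ) R,
      ‖S.expect (fun U => F₁ U * F₂ U) V z - S.expect F₁ V z * S.expect F₂ V z‖ ≤ K :=
    fun z hz => (norm_truncatedExpect_le_const hR ((mem_ball_zero_iff.1 hz).le.trans hRβ) h₁m h₂m
      h₁b h₂b hF₁ hF₂ V).trans hK
  exact leading_floor hdiff hKball hb hLC hr hrR hβ

end System

/-! ## 3. The torus Wilson states: hypothesis (U′) at strong coupling from (LC) -/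

section Torus
variable {d N : ℕ} {G : Type} [Group G] [TopologicalSpace G] [IsTopologicalGroup G]
  [CompactSpace G] [MeasurableSpace G] [BorelSpace G] (ρ : G →* Matrix (Fin N) (Fin N) ℂ)

/-- The complex truncated torus expectation of the periodised observables `F₁` and `F₂ ∘ θ_x` on
the torus of side `L'`: the analytic continuation in the coupling `β` of
`⟨F₁ (F₂∘θ_x)⟩_{L',β} − ⟨F₁⟩_{L',β}⟨F₂∘θ_x⟩_{L',β}`, realised in the torus plaquette system
`torusSystem ρ L'` (`StrongCouplingTorusSystem`; `abs_truncated_eq_norm_torusTruncC`). [folklore] -/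
def torusTruncC (L' : ℕ) [NeZero L'] (F₁ F₂ : ZdGaugeConfig d G → ℝ)
    (x : Literature.Probability.LatticeModels.Site d) (β : ℂ) : ℂ :=
  (torusSystem ρ L').expect (fun U => (F₁ (U ∘ torusRed L') : ℂ) *
      (F₂ (configShift x (U ∘ torusRed L')) : ℂ)) (torusGenuine d L') β -
    (torusSystem ρ L').expect (fun U => (F₁ (U ∘ torusRed L') : ℂ)) (torusGenuine d L') β *
      (torusSystem ρ L').expect (fun U => (F₂ (configShift x (U ∘ torusRed L')) : ℂ))
        (torusGenuine d L') β

/-- For `a, b, c` real (as complex numbers), `|Re a − Re b · Re c| = ‖a − b c‖`. [folklore] -/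
theorem abs_re_sub_mul_re_eq {a b c : ℂ} (ha : a.im = 0) (hb : b.im = 0) (hc : c.im = 0) :
    |a.re - b.re * c.re| = ‖a - b * c‖ := by
  have h : a - b * c = ((a.re - b.re * c.re : ℝ) : ℂ) := by
    apply Complex.ext
    · simp [Complex.sub_re, Complex.mul_re, hb, hc]
    · simp [Complex.sub_im, Complex.mul_im, ha, hb, hc]
  rw [h, Complex.norm_real, Real.norm_eq_abs]

/-- **The real truncated torus correlation is the modulus of `torusTruncC` at real coupling**
(the three Wilson expectations are the real parts of system expectations,
`wilsonExpectation_toTorusObservable_eq_re_expect`, whose imaginary parts vanish,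
`PlaqSystem.expect_ofReal_im`). [folklore] -/
theorem abs_truncated_eq_norm_torusTruncC (hρ : Continuous ρ) (β : ℝ) (L' : ℕ) [NeZero L']
    {F₁ F₂ : ZdGaugeConfig d G → ℝ} (h₁m : Measurable F₁) (h₂m : Measurable F₂) {C₁ C₂ : ℝ}
    (hC₁ : ∀ U, |F₁ U| ≤ C₁) (hC₂ : ∀ U, |F₂ U| ≤ C₂)
    (x : Literature.Probability.LatticeModels.Site d) :
    |wilsonExpectation (L := L') ρ β (toTorusObservable L' fun U => F₁ U * F₂ (configShift x U)) -
        wilsonExpectation (L := L') ρ β (toTorusObservable L' F₁) *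
          wilsonExpectation (L := L') ρ β (toTorusObservable L' (F₂ ∘ configShift x))| =
      ‖torusTruncC ρ L' F₁ F₂ x β‖ := by
  have hC₁0 : 0 ≤ C₁ := (abs_nonneg _).trans (hC₁ fun _ => 1)
  have h2m' : Measurable (F₂ ∘ configShift x) := h₂m.comp (configShift x).measurable
  have h12m : Measurable fun U => F₁ U * F₂ (configShift x U) := h₁m.mul h2m'
  have h12b : ∀ U, |F₁ U * F₂ (configShift x U)| ≤ C₁ * C₂ := fun U => by
    rw [abs_mul]; exact mul_le_mul (hC₁ _) (hC₂ _) (abs_nonneg _) hC₁0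
  rw [wilsonExpectation_toTorusObservable_eq_re_expect ρ hρ β h12m h12b,
    wilsonExpectation_toTorusObservable_eq_re_expect ρ hρ β h₁m hC₁,
    wilsonExpectation_toTorusObservable_eq_re_expect ρ hρ β h2m' (fun U => hC₂ _)]
  have hprod : (fun U : ZdGaugeConfig d G => (((F₁ (U ∘ torusRed L') *
      F₂ (configShift x (U ∘ torusRed L'))) : ℝ) : ℂ)) =
      fun U => (F₁ (U ∘ torusRed L') : ℂ) * (F₂ (configShift x (U ∘ torusRed L')) : ℂ) := by
    funext U; push_cast; rfl
  rw [hprod]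
  unfold torusTruncC
  refine abs_re_sub_mul_re_eq ?_ (PlaqSystem.expect_ofReal_im _ _ _)
    (PlaqSystem.expect_ofReal_im (fun U => (F₂ ∘ configShift x) (U ∘ torusRed L')) _ _)
  have := PlaqSystem.expect_ofReal_im (S := torusSystem ρ L')
    (fun U => F₁ (U ∘ torusRed L') * F₂ (configShift x (U ∘ torusRed L'))) (torusGenuine d L') β
  simpa [hprod] using this

/-- **Hypothesis (U′) at strong coupling from the leading coefficient (LC), uniformly in the
volume.**  `G` compact, `ρ` continuous, `F₁, F₂` bounded measurable local observables of the
infinite lattice, `x` a displacement.  IF for every volume `L` in a set `good` the complex truncated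
torus expectation of side `L+1` has leading term `b βⁿ` at `β = 0`, `b ≠ 0` real (the SAME `b, n`
for all `L ∈ good`; the `O`-constants may depend on `L`), THEN there is ONE `β₀ > 0` such that for
all real `β` with `|β| ≤ β₀` and ALL `L ∈ good`,
`|b| |β|ⁿ / 2 ≤ |⟨F₁ (F₂∘θ_x)⟩_{L+1,β} − ⟨F₁⟩_{L+1,β} ⟨F₂∘θ_x⟩_{L+1,β}|`.
Mechanism: holomorphy and a volume-uniform bound on the strong-coupling disc (the convergent polymer
expansion of the tree, `PlaqSystem.norm_truncatedExpect_le_const`, seeds counted uniformly in `L` by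
`card_seedsOf_torusSystem_le`) + the Schwarz lemma with multiplicity applied to `τ − b βⁿ`
(`leading_floor`). [folklore] -/
theorem torus_truncated_floor_of_leadingCoeff (hρ : Continuous ρ)
    {F₁ F₂ : ZdGaugeConfig d G → ℝ} (hloc₁ : Literature.MathematicalPhysics.QuantumLattice.IsLocalObservable F₁)
    (hloc₂ : Literature.MathematicalPhysics.QuantumLattice.IsLocalObservable F₂)
    (h₁m : Measurable F₁) (h₂m : Measurable F₂) (hb₁ : ∃ C, ∀ U, |F₁ U| ≤ C)
    (hb₂ : ∃ C, ∀ U, |F₂ U| ≤ C) (x : Literature.Probability.LatticeModels.Site d)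
    {n : ℕ} {b : ℝ} (hb : b ≠ 0) (good : Set ℕ)
    (hLC : ∀ L ∈ good, (fun β : ℂ => torusTruncC ρ (L + 1) F₁ F₂ x β - (b : ℂ) * β ^ n)
      =O[𝓝 (0 : ℂ)] fun β => β ^ (n + 1)) :
    ∃ β₀ : ℝ, 0 < β₀ ∧ ∀ L ∈ good, ∀ β : ℝ, |β| ≤ β₀ →
      |b| * |β| ^ n / 2 ≤
        |wilsonExpectation (L := L + 1) ρ β
              (toTorusObservable (L + 1) fun U => F₁ U * F₂ (configShift x U)) -
            wilsonExpectation (L := L + 1) ρ β (toTorusObservable (L + 1) F₁) *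
              wilsonExpectation (L := L + 1) ρ β (toTorusObservable (L + 1) (F₂ ∘ configShift x))| := by
  classical
  obtain ⟨B₁, hB₁⟩ := hloc₁
  obtain ⟨S₂, hS₂⟩ := hloc₂
  obtain ⟨C₁, hC₁⟩ := hb₁
  obtain ⟨C₂, hC₂⟩ := hb₂
  have hC₁0 : 0 ≤ C₁ := (abs_nonneg _).trans (hC₁ fun _ => 1)
  have hC₂0 : 0 ≤ C₂ := (abs_nonneg _).trans (hC₂ fun _ => 1)
  -- the radii of the strong-coupling disc
  set R : ℝ := betaOne d ρ with hRdef
  have hR : 0 < R := betaOne_pos d (ρ := ρ)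
  set r : ℝ := R / 2 with hrdef
  have hr : 0 < r := by positivity
  have hrR : r < R := by rw [hrdef]; linarith
  -- the volume-uniform constant
  set sB : ℕ := (B₁.card + S₂.card) * (2 ^ d * (d * d)) with hsB
  set κ : ℝ := 2 * Real.exp (1 / 2) with hκ
  have hκ1 : 1 ≤ κ := by
    rw [hκ]; have := Real.one_lt_exp_iff.2 (by norm_num : (0 : ℝ) < 1 / 2); linarith
  set Kunif : ℝ := C₁ * C₂ * κ ^ sB + C₁ * κ ^ sB * (C₂ * κ ^ sB) with hKunif
  have hKunif0 : 0 ≤ Kunif := by positivity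
  have hbC : (b : ℂ) ≠ 0 := Complex.ofReal_ne_zero.2 hb
  set β₀ : ℝ := ‖(b : ℂ)‖ * r ^ (n + 1) / (2 * (Kunif + ‖(b : ℂ)‖ * R ^ n)) with hβ₀
  refine ⟨β₀, leading_threshold_pos hKunif0 hR hr hbC, fun L hL β hβ => ?_⟩
  -- the torus system of side `L + 1`
  set L' : ℕ := L + 1 with hL'
  have hReg : (torusSystem (d := d) (G := G) ρ L').Regular (costBound ρ) (Plaq.degBound d) :=
    torusSystem_regular ρ hρ
  -- the twisted observables
  set Φ₁ : ZdGaugeConfig d G → ℂ := fun U => (F₁ (U ∘ torusRed L') : ℂ) with hΦ₁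
  set Φ₂ : ZdGaugeConfig d G → ℂ := fun U => (F₂ (configShift x (U ∘ torusRed L')) : ℂ) with hΦ₂
  set B₂ : Finset (ZdEdge d) := S₂.image fun e => (e.1 - x, e.2) with hB₂
  have hΦ₁m : Measurable Φ₁ :=
    Complex.measurable_ofReal.comp (h₁m.comp (measurable_comp_relabel (torusRed L')))
  have hΦ₂m : Measurable Φ₂ :=
    Complex.measurable_ofReal.comp ((h₂m.comp (configShift x).measurable).comp
      (measurable_comp_relabel (torusRed L')))
  have hΦ₁b : ∀ U, ‖Φ₁ U‖ ≤ C₁ := fun U => by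
    rw [hΦ₁, Complex.norm_real, Real.norm_eq_abs]; exact hC₁ _
  have hΦ₂b : ∀ U, ‖Φ₂ U‖ ≤ C₂ := fun U => by
    rw [hΦ₂, Complex.norm_real, Real.norm_eq_abs]; exact hC₂ _
  have hΦ₁d : DependsOn Φ₁ ((B₁.image (torusRed L') : Finset (ZdEdge d)) : Set (ZdEdge d)) :=
    dependsOn_comp_torusRed L' (F := fun U => (F₁ U : ℂ)) fun U V h => by
      show (F₁ U : ℂ) = F₁ V; rw [hB₁ h]
  have hΦ₂d : DependsOn Φ₂ ((B₂.image (torusRed L') : Finset (ZdEdge d)) : Set (ZdEdge d)) := by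
    have h := IsCylinder.comp_configShift hS₂ x
    exact dependsOn_comp_torusRed L' (F := fun U => ((F₂ ∘ configShift x) U : ℂ)) fun U V h' => by
      show (((F₂ ∘ configShift x) U : ℝ) : ℂ) = ((F₂ ∘ configShift x) V : ℝ); rw [h h']
  -- seed counts, uniformly in `L`
  have hs₁ : ((torusSystem (G := G) ρ L').seedsOf (B₁.image (torusRed L'))).card ≤ sB := by
    refine (card_seedsOf_torusSystem_le ρ B₁).trans ((card_seedsOf_le_mul B₁).trans ?_)
    rw [hsB]; exact Nat.mul_le_mul_right _ (Nat.le_add_right _ _)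
  have hB₂c : B₂.card ≤ S₂.card := Finset.card_image_le
  have hs₂ : ((torusSystem (G := G) ρ L').seedsOf (B₂.image (torusRed L'))).card ≤ sB := by
    refine (card_seedsOf_torusSystem_le ρ B₂).trans ((card_seedsOf_le_mul B₂).trans ?_)
    rw [hsB]; exact Nat.mul_le_mul_right _ (hB₂c.trans (Nat.le_add_left _ _))
  have hs₁₂ : ((torusSystem (G := G) ρ L').seedsOf
      (B₁.image (torusRed L') ∪ B₂.image (torusRed L'))).card ≤ sB := by
    rw [← Finset.image_union]
    refine (card_seedsOf_torusSystem_le ρ _).trans ((card_seedsOf_le_mul _).trans ?_)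
    rw [hsB]
    exact Nat.mul_le_mul_right _ ((Finset.card_union_le _ _).trans (Nat.add_le_add_left hB₂c _))
  have hK : C₁ * C₂ * κ ^ ((torusSystem (G := G) ρ L').seedsOf
        (B₁.image (torusRed L') ∪ B₂.image (torusRed L'))).card +
      C₁ * κ ^ ((torusSystem (G := G) ρ L').seedsOf (B₁.image (torusRed L'))).card *
        (C₂ * κ ^ ((torusSystem (G := G) ρ L').seedsOf (B₂.image (torusRed L'))).card) ≤ Kunif := by
    rw [hKunif]
    refine add_le_add (mul_le_mul_of_nonneg_left (pow_le_pow_right₀ hκ1 hs₁₂) (by positivity))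
      (mul_le_mul (mul_le_mul_of_nonneg_left (pow_le_pow_right₀ hκ1 hs₁) hC₁0)
        (mul_le_mul_of_nonneg_left (pow_le_pow_right₀ hκ1 hs₂) hC₂0) (by positivity)
        (by positivity))
  -- the coupling is below the threshold
  have hRβ : R ≤ PlaqSystem.betaR (costBound ρ) (Plaq.degBound d) := by rw [betaR_costBound]
  have hβC : ‖(β : ℂ)‖ ≤ ‖(b : ℂ)‖ * r ^ (n + 1) / (2 * (Kunif + ‖(b : ℂ)‖ * R ^ n)) := by
    rw [Complex.norm_real, Real.norm_eq_abs]; exact hβ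
  -- the floor for the complex truncated expectation, then back to the real one
  have hLC' : (fun z : ℂ => ((torusSystem ρ L').expect (fun U => Φ₁ U * Φ₂ U) (torusGenuine d L') z -
      (torusSystem ρ L').expect Φ₁ (torusGenuine d L') z *
        (torusSystem ρ L').expect Φ₂ (torusGenuine d L') z) - (b : ℂ) * z ^ n)
      =O[𝓝 (0 : ℂ)] fun z => z ^ (n + 1) := hLC L hL
  have hfloor := PlaqSystem.truncated_floor_of_leading hReg hΦ₁m hΦ₂m hΦ₁b hΦ₂b hΦ₁d hΦ₂d
    (torusGenuine d L') hK hr hrR hRβ hbC hLC' hβC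
  rw [abs_truncated_eq_norm_torusTruncC ρ hρ β L' h₁m h₂m hC₁ hC₂ x]
  have hnb : ‖(b : ℂ)‖ = |b| := by rw [Complex.norm_real, Real.norm_eq_abs]
  have hnβ : ‖(β : ℂ)‖ = |β| := by rw [Complex.norm_real, Real.norm_eq_abs]
  rw [hnb, hnβ] at hfloor
  exact hfloor

/-- **Corollary — hypothesis (U′) in the venture's shape** (`∃ δ > 0 ∀ L`, at each fixed strong
coupling): under (LC) on `good`, for every real `β` with `0 < |β| ≤ β₀` there is `δ = |b||β|ⁿ/2 > 0`
with `δ ≤ |⟨F₁ (F₂∘θ_x)⟩_{L+1,β} − ⟨F₁⟩_{L+1,β}⟨F₂∘θ_x⟩_{L+1,β}|` for ALL `L ∈ good`. [folklore] -/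
theorem torus_clusteringFloor_of_leadingCoeff (hρ : Continuous ρ)
    {F₁ F₂ : ZdGaugeConfig d G → ℝ} (hloc₁ : Literature.MathematicalPhysics.QuantumLattice.IsLocalObservable F₁)
    (hloc₂ : Literature.MathematicalPhysics.QuantumLattice.IsLocalObservable F₂)
    (h₁m : Measurable F₁) (h₂m : Measurable F₂) (hb₁ : ∃ C, ∀ U, |F₁ U| ≤ C)
    (hb₂ : ∃ C, ∀ U, |F₂ U| ≤ C) (x : Literature.Probability.LatticeModels.Site d)
    {n : ℕ} {b : ℝ} (hb : b ≠ 0) (good : Set ℕ)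
    (hLC : ∀ L ∈ good, (fun β : ℂ => torusTruncC ρ (L + 1) F₁ F₂ x β - (b : ℂ) * β ^ n)
      =O[𝓝 (0 : ℂ)] fun β => β ^ (n + 1)) :
    ∃ β₀ : ℝ, 0 < β₀ ∧ ∀ β : ℝ, β ≠ 0 → |β| ≤ β₀ → ∃ δ : ℝ, 0 < δ ∧ ∀ L ∈ good,
      δ ≤ |wilsonExpectation (L := L + 1) ρ β
              (toTorusObservable (L + 1) fun U => F₁ U * F₂ (configShift x U)) -
            wilsonExpectation (L := L + 1) ρ β (toTorusObservable (L + 1) F₁) *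
              wilsonExpectation (L := L + 1) ρ β (toTorusObservable (L + 1) (F₂ ∘ configShift x))| := by
  obtain ⟨β₀, hβ₀, h⟩ :=
    torus_truncated_floor_of_leadingCoeff ρ hρ hloc₁ hloc₂ h₁m h₂m hb₁ hb₂ x hb good hLC
  refine ⟨β₀, hβ₀, fun β hβ0 hβ => ⟨|b| * |β| ^ n / 2, ?_, fun L hL => h L hL β hβ⟩⟩
  have hb' : 0 < |b| := abs_pos.2 hb
  have hβ' : 0 < |β| := abs_pos.2 hβ0
  positivity

end Torus

end Summit.Ventures.LatticeQCDFlow.Theory2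

end
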